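import Summits.ABC.IUTFork.Conditional.AbcOfSDegreeCutJunction
import HarnessLib

/-!
# Branch C «abc ⇐ S»: the DEGREE CUT junctions for the SZPIRO-BAD books — the CONE binder `hregBad` and the NUM-1.10 binder `hSqMix`
# (Szpiro-bad guard) are VOID at every point with `d_mod = 1`, exactly as their content-locus twins (abc-iut cell, branch C, sequel
# «DEGREE CUT», junction file 2; seat abc-iut-C-cert-2 gen 7)

Record-only PROOF file (D-0012; 0 definitions, 0 `Prop` facts, nothing re-typed; binder texts VERBATIM as p453137 / p457468 and their M twins)
of the abc-iut cell. TAKES NO SIDE on [IUTchIII] Cor. 3.12, on [IUTchIV] Thm. 1.10, on (U)/(P), or on any author. Same mathematics as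
`AbcOfSDegreeCutJunction` (p513269): at `d_mod = 1` every genuine datum is slot-constant (abc-iut-c312-d1
`DHData.slotConstant_of_finrank_eq_one`, abc-iut-S-d2 `finrank_rat_fieldOfModuli_eq_dmod`) and no prime is mixed (`M = ∅`;
`DHData.placesOver_subsingleton_of_finrank_eq_one`); only the GUARD line of the binder differs (Szpiro-bad instead of content):

* **`DegCut.hregBad_of_degCut`** — [CONE, Szpiro-bad] `hregBadD` (text VERBATIM + «`2 ≤ Cor22.dmod P →`») ⟹ `hregBad`;
* **`DegCut.hSqMix_of_degCut`** — [NUM-1.10, Szpiro-bad ∧ mixing] `hSqMixD` ⟹ `hSqMix`.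

A cut discharges nothing; counts unchanged in every book that uses these junctions; «void at `d_mod = 1`» is a theorem about these binders'
ANTECEDENTS, not about S_H. Typed ≠ proved; instantiated ≠ endorsed; no abc claim. [cite: Mochizuki2012, IUTchIV Thm. 1.10 p. 22–24, Steps (v)
p. 27–28, (viii) p. 30, Cor. 2.2 (ii) p. 44–46] [cite: DupuyHilado2025, §3.6, §4.12] [claim: Mochizuki2012, status: disputed] for every IUT quotation.
-/

noncomputable section

open Set Function NumberField IsDedekindDomain

namespace Summit.ABC.IUTFork.Conditional

open Thm311 Thm311.Real Cor312 Cor312Vol Cor312Prov Literature.IUT.LogThetaLattice Literature.IUT.LogVolume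
  Literature.IUT.HodgeTheaters Literature.IUT.LogVolume.ThetaData Literature.IUT.LogVolume.Cor22
open Literature.NumberTheory.NumberFields Literature.NumberTheory.GaloisRepresentations.Ultrametric
open Literature.NumberTheory.DiophantineGeometry Literature.NumberTheory.DiophantineGeometry.GenEll Summit.ABC.ABC.Theorems
open scoped Classical

/-! ## §1. The two degree-cut junctions, Szpiro-bad guard (data-free) -/

/-- **[CONE, Szpiro-bad] degree cut**: `hregBadD` ⟹ `hregBad` (at `d_mod = 1` the antecedent «not slot-constant» is void).
[cite: Mochizuki2012, IUTchIV Thm. 1.10 Step (v) p. 27–28] [claim: Mochizuki2012, status: disputed] -/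
theorem DegCut.hregBad_of_degCut
    -- [CONE, SZPIRO-BAD] the hull estimate with print's `B_III(P,l)` off the slot-constant regime, ONLY at SZPIRO-BAD admissible points (C-R28 (3)(α))
    (hregBadD : ∀ P : NFPoint, P ∈ UP → ∀ l : ℕ, l.Prime → 5 ≤ l →
      -- DEGREE CUT: ONLY at points with `d_mod ≥ 2` — at `d_mod = 1` (`F_mod = ℚ`: ONE place over each prime) every datum is slot-constant and no prime is mixed, so the antecedent below is void
      2 ≤ Cor22.dmod P →
      Cor22.AdmitsCore P → Cor22.CondP2 P l → Cor22.CondP5 P l → Cor22.CondP6 P l →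
      (((l : ℝ) + 5) / 4 < (Cor22.dmod P : ℝ) ∨
        6 * l * (((l : ℝ) + 5) - 4 * Cor22.dmod P) / (((l : ℝ) + 4) * ((l : ℝ) - 3))
            * (P.logDiff + (1 - 1 / (l : ℝ)) * Cor22.logCondAvoid P {2, l})
          + 6 * l * ((l : ℝ) + 5) / (((l : ℝ) + 4) * ((l : ℝ) - 3)) * Real.log Real.pi < Cor22.logQAvoid P {2, l}) →
      ∀ T : Cor22.ThetaVolumeDatumAt P l,
        (letI := T.instFieldF; letI := T.instNumberFieldF; letI := T.instAlgebraF; letI := T.instFieldK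
         letI := T.instNumberFieldK; letI := T.instAlgebraK; letI := T.instFieldFbar; letI := T.instAlgebraFbar
         letI := T.instAlgebraKFbar; letI := T.instIsElliptic
         ¬ (∀ p ∈ T.I.supportPrimes, ∀ v w : placesOver (fieldOfModuli T.E) p,
            (Summit.ABC.IUTFork.DHData.ofInput T.I).logQloc p v = (Summit.ABC.IUTFork.DHData.ofInput T.I).logQloc p w)) →
        T.HullEstimateOf
          (((l : ℝ) + 1) / 4 *
            ((1 + 12 * (Cor22.dmod P : ℝ) / l) * (P.logDiff + Cor22.logCondAvoid P {2, l})
              + 2 * Real.log l + 52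
              + 20 / 3 * Real.log (((2 ^ 12 * 3 ^ 3 * 5 * Cor22.dmod P : ℕ) : ℝ) * (l : ℝ))
                * (Nat.primeCounting (2 ^ 12 * 3 ^ 3 * 5 * Cor22.dmod P * l) : ℝ)))) :
    ∀ P : NFPoint, P ∈ UP → ∀ l : ℕ, l.Prime → 5 ≤ l →
      Cor22.AdmitsCore P → Cor22.CondP2 P l → Cor22.CondP5 P l → Cor22.CondP6 P l →
      (((l : ℝ) + 5) / 4 < (Cor22.dmod P : ℝ) ∨
        6 * l * (((l : ℝ) + 5) - 4 * Cor22.dmod P) / (((l : ℝ) + 4) * ((l : ℝ) - 3))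
            * (P.logDiff + (1 - 1 / (l : ℝ)) * Cor22.logCondAvoid P {2, l})
          + 6 * l * ((l : ℝ) + 5) / (((l : ℝ) + 4) * ((l : ℝ) - 3)) * Real.log Real.pi < Cor22.logQAvoid P {2, l}) →
      ∀ T : Cor22.ThetaVolumeDatumAt P l,
        (letI := T.instFieldF; letI := T.instNumberFieldF; letI := T.instAlgebraF; letI := T.instFieldK
         letI := T.instNumberFieldK; letI := T.instAlgebraK; letI := T.instFieldFbar; letI := T.instAlgebraFbar
         letI := T.instAlgebraKFbar; letI := T.instIsElliptic
         ¬ (∀ p ∈ T.I.supportPrimes, ∀ v w : placesOver (fieldOfModuli T.E) p,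
            (Summit.ABC.IUTFork.DHData.ofInput T.I).logQloc p v = (Summit.ABC.IUTFork.DHData.ofInput T.I).logQloc p w)) →
        T.HullEstimateOf
          (((l : ℝ) + 1) / 4 *
            ((1 + 12 * (Cor22.dmod P : ℝ) / l) * (P.logDiff + Cor22.logCondAvoid P {2, l})
              + 2 * Real.log l + 52
              + 20 / 3 * Real.log (((2 ^ 12 * 3 ^ 3 * 5 * Cor22.dmod P : ℕ) : ℝ) * (l : ℝ))
                * (Nat.primeCounting (2 ^ 12 * 3 ^ 3 * 5 * Cor22.dmod P * l) : ℝ))) :=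
  fun P hP l hl h5 => by
    by_cases hd : Cor22.dmod P = 1
    · intro _ _ _ _ _ T hnc
      letI := T.instFieldF; letI := T.instNumberFieldF; letI := T.instAlgebraF; letI := T.instFieldK
      letI := T.instNumberFieldK; letI := T.instAlgebraK; letI := T.instFieldFbar; letI := T.instAlgebraFbar
      letI := T.instAlgebraKFbar; letI := T.instIsElliptic
      have hF : Module.finrank ℚ (fieldOfModuli T.E) = 1 := T.finrank_rat_fieldOfModuli_eq_dmod.trans hd
      exact (hnc fun p hp v w => by
        haveI : Fact p.Prime := ⟨T.I.prime_of_mem_supportPrimes hp⟩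
        exact DHData.slotConstant_of_finrank_eq_one hF (fun v => (Summit.ABC.IUTFork.DHData.ofInput T.I).logQloc p v) v w).elim
    · exact hregBadD P hP l hl h5 (by have := Cor22.dmod_pos P; omega)

/-- **[NUM-1.10, Szpiro-bad ∧ mixing] degree cut**: `hSqMixD` ⟹ `hSqMix` (at `d_mod = 1` the witness `M = ∅` puts the point off the mixing
locus). [cite: Mochizuki2012, IUTchIV Thm. 1.10 Step (viii) p. 30] [cite: DupuyHilado2025, §3.6] [claim: Mochizuki2012, status: disputed] -/
theorem DegCut.hSqMix_of_degCut
    -- [NUM-1.10, Szpiro-bad ∧ mixing] [IUTchIV] Thm 1.10 Step (viii)'s squeeze at the admissible SZPIRO-BAD points IN the mixing locus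
    -- (the negation of abc-iut-s2-p1's off-locus condition of `Conditional.hvol_offMixingLocus_holds`, VERBATIM)
    (hSqMixD : ∀ P : NFPoint, P ∈ UP → ∀ l : ℕ, l.Prime → 5 ≤ l →
      -- DEGREE CUT: ONLY at points with `d_mod ≥ 2` — at `d_mod = 1` (`F_mod = ℚ`: ONE place over each prime) every datum is slot-constant and no prime is mixed, so the antecedent below is void
      2 ≤ Cor22.dmod P →
      Cor22.AdmitsCore P → Cor22.CondP2 P l → Cor22.CondP5 P l → Cor22.CondP6 P l →
      (((l : ℝ) + 5) / 4 < (Cor22.dmod P : ℝ) ∨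
        6 * l * (((l : ℝ) + 5) - 4 * Cor22.dmod P) / (((l : ℝ) + 4) * ((l : ℝ) - 3))
            * (P.logDiff + (1 - 1 / (l : ℝ)) * Cor22.logCondAvoid P {2, l})
          + 6 * l * ((l : ℝ) + 5) / (((l : ℝ) + 4) * ((l : ℝ) - 3)) * Real.log Real.pi < Cor22.logQAvoid P {2, l}) →
      ¬ (∃ M : Finset ℕ,
        (∀ p : ℕ, p.Prime →
          (¬ ∀ V W : HeightOneSpectrum (𝓞 ↥(IntermediateField.adjoin ℚ ({Cor22.jInv P.x} : Set P.F))),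
            V ∈ placesOver _ p → W ∈ placesOver _ p →
            (if ord _ V (Cor22.jMod P) < 0 ∧ ((2 : ℕ) : 𝓞 _) ∉ V.asIdeal ∧ ((l : ℕ) : 𝓞 _) ∉ V.asIdeal
              then ((-ord _ V (Cor22.jMod P) : ℤ) : ℝ) * logNorm _ V / (localDegree _ V : ℝ) else 0) =
            (if ord _ W (Cor22.jMod P) < 0 ∧ ((2 : ℕ) : 𝓞 _) ∉ W.asIdeal ∧ ((l : ℕ) : 𝓞 _) ∉ W.asIdeal
              then ((-ord _ W (Cor22.jMod P) : ℤ) : ℝ) * logNorm _ W / (localDegree _ W : ℝ) else 0)) → p ∈ M) ∧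
        ((l : ℝ) + 1) / 24 *
            ∑ p ∈ M, ∑ V : placesOver ↥(IntermediateField.adjoin ℚ ({Cor22.jInv P.x} : Set P.F)) p,
              (if ord _ V.1 (Cor22.jMod P) < 0 ∧ ((2 : ℕ) : 𝓞 _) ∉ V.1.asIdeal ∧ ((l : ℕ) : 𝓞 _) ∉ V.1.asIdeal then
                weight _ V.1 * (((-ord _ V.1 (Cor22.jMod P) : ℤ) : ℝ) * logNorm _ V.1 / (localDegree _ V.1 : ℝ))
               else 0) ≤
          ((l : ℝ) + 1) / 4 * (4 * ((Cor22.dmod P : ℝ) - 1) / l * (P.logDiff + Cor22.logCondAvoid P {2, l})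
            + 20 / 3 * Real.log (((2 ^ 12 * 3 ^ 3 * 5 * Cor22.dmod P : ℕ) : ℝ) * l)
              * max 0 (((Nat.primeCounting (2 ^ 12 * 3 ^ 3 * 5 * Cor22.dmod P * l) : ℝ)
                - (2 * (Cor22.dmod P : ℝ) * (P.logDiff + Cor22.logCondAvoid P {2, l}) + Real.log (2 * 3 * 5 * (l : ℝ)))
                  / Real.log 2)))) →
      (((l : ℝ) + 1) / 24 - 1 / (2 * l)) * Cor22.logQAvoid P {2, l} ≤
        ((l : ℝ) + 1) / 4 *
          ((1 + 12 * (Cor22.dmod P : ℝ) / l) * (P.logDiff + Cor22.logCondAvoid P {2, l})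
            + 2 * Real.log l + 52
            + 20 / 3 * Real.log (((2 ^ 12 * 3 ^ 3 * 5 * Cor22.dmod P : ℕ) : ℝ) * (l : ℝ))
              * (Nat.primeCounting (2 ^ 12 * 3 ^ 3 * 5 * Cor22.dmod P * l) : ℝ))
        + ThetaVolumeInput.archLogTheta l) :
    ∀ P : NFPoint, P ∈ UP → ∀ l : ℕ, l.Prime → 5 ≤ l →
      Cor22.AdmitsCore P → Cor22.CondP2 P l → Cor22.CondP5 P l → Cor22.CondP6 P l →
      (((l : ℝ) + 5) / 4 < (Cor22.dmod P : ℝ) ∨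
        6 * l * (((l : ℝ) + 5) - 4 * Cor22.dmod P) / (((l : ℝ) + 4) * ((l : ℝ) - 3))
            * (P.logDiff + (1 - 1 / (l : ℝ)) * Cor22.logCondAvoid P {2, l})
          + 6 * l * ((l : ℝ) + 5) / (((l : ℝ) + 4) * ((l : ℝ) - 3)) * Real.log Real.pi < Cor22.logQAvoid P {2, l}) →
      ¬ (∃ M : Finset ℕ,
        (∀ p : ℕ, p.Prime →
          (¬ ∀ V W : HeightOneSpectrum (𝓞 ↥(IntermediateField.adjoin ℚ ({Cor22.jInv P.x} : Set P.F))),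
            V ∈ placesOver _ p → W ∈ placesOver _ p →
            (if ord _ V (Cor22.jMod P) < 0 ∧ ((2 : ℕ) : 𝓞 _) ∉ V.asIdeal ∧ ((l : ℕ) : 𝓞 _) ∉ V.asIdeal
              then ((-ord _ V (Cor22.jMod P) : ℤ) : ℝ) * logNorm _ V / (localDegree _ V : ℝ) else 0) =
            (if ord _ W (Cor22.jMod P) < 0 ∧ ((2 : ℕ) : 𝓞 _) ∉ W.asIdeal ∧ ((l : ℕ) : 𝓞 _) ∉ W.asIdeal
              then ((-ord _ W (Cor22.jMod P) : ℤ) : ℝ) * logNorm _ W / (localDegree _ W : ℝ) else 0)) → p ∈ M) ∧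
        ((l : ℝ) + 1) / 24 *
            ∑ p ∈ M, ∑ V : placesOver ↥(IntermediateField.adjoin ℚ ({Cor22.jInv P.x} : Set P.F)) p,
              (if ord _ V.1 (Cor22.jMod P) < 0 ∧ ((2 : ℕ) : 𝓞 _) ∉ V.1.asIdeal ∧ ((l : ℕ) : 𝓞 _) ∉ V.1.asIdeal then
                weight _ V.1 * (((-ord _ V.1 (Cor22.jMod P) : ℤ) : ℝ) * logNorm _ V.1 / (localDegree _ V.1 : ℝ))
               else 0) ≤
          ((l : ℝ) + 1) / 4 * (4 * ((Cor22.dmod P : ℝ) - 1) / l * (P.logDiff + Cor22.logCondAvoid P {2, l})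
            + 20 / 3 * Real.log (((2 ^ 12 * 3 ^ 3 * 5 * Cor22.dmod P : ℕ) : ℝ) * l)
              * max 0 (((Nat.primeCounting (2 ^ 12 * 3 ^ 3 * 5 * Cor22.dmod P * l) : ℝ)
                - (2 * (Cor22.dmod P : ℝ) * (P.logDiff + Cor22.logCondAvoid P {2, l}) + Real.log (2 * 3 * 5 * (l : ℝ)))
                  / Real.log 2)))) →
      (((l : ℝ) + 1) / 24 - 1 / (2 * l)) * Cor22.logQAvoid P {2, l} ≤
        ((l : ℝ) + 1) / 4 *
          ((1 + 12 * (Cor22.dmod P : ℝ) / l) * (P.logDiff + Cor22.logCondAvoid P {2, l})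
            + 2 * Real.log l + 52
            + 20 / 3 * Real.log (((2 ^ 12 * 3 ^ 3 * 5 * Cor22.dmod P : ℕ) : ℝ) * (l : ℝ))
              * (Nat.primeCounting (2 ^ 12 * 3 ^ 3 * 5 * Cor22.dmod P * l) : ℝ))
        + ThetaVolumeInput.archLogTheta l :=
  fun P hP l hl h5 => by
    by_cases hd : Cor22.dmod P = 1
    · intro _ _ _ _ _ hnot
      have hF : Module.finrank ℚ ↥(IntermediateField.adjoin ℚ ({Cor22.jInv P.x} : Set P.F)) = 1 := hd
      refine (hnot ⟨∅, fun p hp hne => (hne fun V W hV hW => ?_).elim, ?_⟩).elim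
      · haveI : Fact p.Prime := ⟨hp⟩
        have hVW : V = W := congrArg Subtype.val (DHData.placesOver_subsingleton_of_finrank_eq_one hF p ⟨V, hV⟩ ⟨W, hW⟩)
        subst hVW
        rfl
      · have hd' : (Cor22.dmod P : ℝ) = 1 := by exact_mod_cast hd
        simp only [Finset.sum_empty, mul_zero, hd', sub_self, zero_div, zero_mul, zero_add]
        have h1 : (1 : ℝ) ≤ ((2 ^ 12 * 3 ^ 3 * 5 * Cor22.dmod P : ℕ) : ℝ) := by
          have : 1 ≤ 2 ^ 12 * 3 ^ 3 * 5 * Cor22.dmod P := by rw [hd]; norm_num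
          exact_mod_cast this
        have h2 : (1 : ℝ) ≤ (l : ℝ) := by exact_mod_cast hl.one_lt.le
        have hlog : 0 ≤ Real.log (((2 ^ 12 * 3 ^ 3 * 5 * Cor22.dmod P : ℕ) : ℝ) * (l : ℝ)) := Real.log_nonneg (by nlinarith)
        exact mul_nonneg (by positivity) (mul_nonneg (mul_nonneg (by norm_num) hlog) (le_max_left _ _))
    · exact hSqMixD P hP l hl h5 (by have := Cor22.dmod_pos P; omega)

end Summit.ABC.IUTFork.Conditional

end
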